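import Literature.NumberTheory.EllipticCurves.DeShalit1987.CMFormalActionReadingSeries
import Literature.NumberTheory.EllipticCurves.DeShalit1987.CMFormalActionReadingIdentities
import Literature.NumberTheory.EllipticCurves.CMTransformationPairSeven
import Literature.NumberTheory.EllipticCurves.X049IntegralModelReadings
import Literature.NumberTheory.EllipticCurves.WeierstrassTorsion
import HarnessLib

/-!
# The CM datum OVER THE `𝔓`-ADIC READING RING: the «formal CM action / transformation pair / series identities» binder block of the
# (α)-bridge `exists_unit_forall_relColemanSeries_eq_subst_subst_of_thetaReadings` (B10f-d) at `R := DeShalit1987.readingRing E hE`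
# (de Shalit II §1.10, II §4.9 (ii); proofs only)

Cell `bsd-print-cf2`, width seat `bsd-line-cf2-p1-w7` g16 (piece (RP)-THETA-DATUM, part 1 of 2); `--supports` stmt-BirchSwinnertonDyer-24720
(helper, Theses-free).  THEOREMS ONLY; no `def`, no named fact, no `sorry`.

WHAT.  B10f-d (`…KatzMeasureJZeroSeam.exists_unit_forall_relColemanSeries_eq_subst_subst_of_thetaReadings`, p768701) takes, over an abstract data
ring `R` read algebraically by `j : R → K̄`, the formal CM action `T` (`hT0`, `hTP`), a transformation pair `(P_C, Q_C)` of the model lattice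
(`hT`, `hQC`), its re-centred `R`-lifts `(P_r, Q_r, s)` (`hs`, `hQr`, `hPr`) and the two series identities `hidX`/`hidY`.  For
`R := readingRing E hE` (the localisation `𝒪_{F,(𝔓)}` of a ray class field `F = K(𝔪_r)` read into a finite `E/K_v`), the integer model
`W = [1,−1,0,−2,−1]` of `X₀(49)`, its `ℤ₂`-datum `P ↦ exp(c·log)` with `e_K(π₀) = c`, the model lattice `L` (`g₂ = c₄/12`, `g₃ = c₆/216`) and base
points `x₀ y₀ x₁ y₁ ∈ R` reading `ξ(Ω)`, `ξ(π₀Ω)` in MODEL coordinates, `α_R ∈ R` reading `π₀` (`ι(π₀)² = ι(π₀) − 2`), THIS FILE produces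
`T, P_r, Q_r` with ALL those clauses in B10f-d's token shapes (★★ `exists_cmDatum_readingRing`), with the explicit pair
`P_C = (−16 − 16w)X² + (−24 − 8w)X + (−49 + 35w)`, `Q_C = 64X + (64 − 16w)` (`w = ι π₀`) and `s = 1/16`; plus the complex readings of `T` through every
`g : K(𝔪_r) → A` (`hTg`).  Instantiation of B8a `CMFormalActionReadingSeries.exists_readingSeries_cm7FormalMulBy`, B8b
`CMFormalActionReadingIdentities.cmX/cmY_identity_of_reading` (descent along the injective `ι̂ ∘ j`) and (PQ7) `CMTransformationPairSeven`.
The companion file `…SeamThetaDatumReading` supplies `x₀ y₀ x₁ y₁ α_R` with exactly the value clauses assumed here.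

HONEST FRAMING: plumbing of accepted kernel theorems; nothing is closed; no summit statement is proved by this seat; BSD is not proved by any of this.

## References
* [deShalit1987] E. de Shalit, *Iwasawa theory of elliptic curves with complex multiplication* (1987), II §1.10 Lemma (p. 39), II §4.2 (p. 56),
  II §4.9 (ii) (p. 62–63).
* [SilvermanAEC2009] J. H. Silverman, *The Arithmetic of Elliptic Curves*, 2nd ed. (2009), III §1, IV.4–IV.5.
* [Cox2013] D. A. Cox, *Primes of the form x² + ny²*, 2nd ed. (2013), Prop. 14.9.
-/

-- the summit namespace `Summit.BirchSwinnertonDyer.BirchSwinnertonDyer` repeats the problem name by design (D-0017)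
set_option linter.dupNamespace false
set_option autoImplicit false

noncomputable section

open scoped Classical
open scoped NumberField PeriodPair
open PeriodPair Literature.NumberTheory.EllipticCurves Literature.NumberTheory.EllipticCurves.DeShalit1987
open NumberField Field IsDedekindDomain IsDedekindDomain.HeightOneSpectrum ValuativeRel PowerSeries
open Literature.NumberTheory.NumberFields Literature.NumberTheory.ComplexMultiplication.EllipticUnits
open Literature.NumberTheory.GaloisRepresentations Literature.NumberTheory.GaloisRepresentations.IsNonarchimedeanLocalField
  Literature.NumberTheory.GaloisRepresentations.LubinTate _root_.WeierstrassCurve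

namespace Summit.BirchSwinnertonDyer.BirchSwinnertonDyer.Theorems.PrintCf2.KatzMeasureJZeroSeam

attribute [local instance] ltNormUniformSpace ltNormIsUniformAddGroup rk1 nF nE fintypeResidueField

set_option maxHeartbeats 400000 in
/-- ★★ **The CM datum over the `𝔓`-adic reading ring** — see the module docstring.  With `R := readingRing E hE`, `ψ := readingHom E hE`,
`j := (K(𝔪_r) ⊂ K̄) ∘ subtype`: `∃ T Pr Qr` with the clauses hT0 · hTP · hTg · hT · hQC · hs · hQr · hPr · hidX · hidY of B10f-d at `F := K_v`,
`e := (integerEquivAdicCompletionIntegers v).trans (padicIntEquivOfDegreeOne K 2 v he hf)`, `PC, QC` the model pair, `s := 1/16`.  (Heartbeats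
raised to `400000` for the size of the statement only.) [cite: deShalit1987, II §1.10 Lemma (p. 39), II §4.9 (ii) (p. 62–63)]
[cite: SilvermanAEC2009, III §1, IV.4–IV.5] [cite: Cox2013, Prop. 14.9] -/
theorem exists_cmDatum_readingRing
    -- the base field, the split prime `v ∣ 2` of degree one, the embedding
    {K : Type} [Field K] [NumberField K] {v : HeightOneSpectrum (𝓞 K)} [v.asIdeal.LiesOver (ratPlace 2).asIdeal]
    (he : v.asIdeal.ramificationIdx (𝓞 ℚ) = 1) (hf : v.asIdeal.inertiaDeg (𝓞 ℚ) = 1) (ι : K →+* ℂ)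
    -- the reading level `K(𝔪r)` and the reading field `E ⊇ e(K(𝔪r))`
    {𝔪r : Ideal (𝓞 K)}
    (E : IntermediateField (v.adicCompletion K) (AlgebraicClosure (v.adicCompletion K)))
    [FiniteDimensional (v.adicCompletion K) E]
    (hE : ∀ y : AlgebraicClosure K, y ∈ rayClassField K 𝔪r → absClosureEmbedding K (v.adicCompletion K) y ∈ E)
    -- the `ℤ₂`-datum of `[1,−1,0,−2,−1]` (cm7Padic) and the integer model
    {c : ℤ_[2]} {P : PowerSeries ℤ_[2]}
    (hPexp : P.map PadicInt.Coe.ringHom =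
      ((⟨1, -1, 0, -2, -1⟩ : WeierstrassCurve ℤ_[2]).map PadicInt.Coe.ringHom).formalExp.subst
        (C (c : ℚ_[2]) * ((⟨1, -1, 0, -2, -1⟩ : WeierstrassCurve ℤ_[2]).map PadicInt.Coe.ringHom).formalLog))
    (W : WeierstrassCurve ℤ) (hW : W = ⟨1, -1, 0, -2, -1⟩)
    {π₀ : 𝓞 K} (hc : padicEquivOfDegreeOne K 2 v he hf (algebraMap K (v.adicCompletion K) (π₀ : K)) = c)
    (hw : ι (π₀ : K) ^ 2 = ι (π₀ : K) - 2)
    -- the model lattice and the base point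
    (L : PeriodPair) {Ω : ℂ} (h₂ : L.g₂ = (W.baseChange ℂ).c₄ / 12) (h₃ : L.g₃ = (W.baseChange ℂ).c₆ / 216)
    (hΩL : Ω ∉ L.lattice) (hπΩL : ι (π₀ : K) * Ω ∉ L.lattice)
    (h2Ω : (2 : ℂ) * Ω ∉ L.lattice) (h2Ω₁ : (2 : ℂ) * (ι (π₀ : K) * Ω) ∉ L.lattice)
    -- the base points and `α_R` over `R`, read in MODEL coordinates
    (x₀ y₀ x₁ y₁ αR : readingRing E hE)
    (hx₀ : algClosureEmb ι (((algebraMap (rayClassField K 𝔪r) (AlgebraicClosure K)).comp (readingRing E hE).subtype) x₀) =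
      ℘[L] Ω - (W.baseChange ℂ).b₂ / 12)
    (hy₀ : algClosureEmb ι (((algebraMap (rayClassField K 𝔪r) (AlgebraicClosure K)).comp (readingRing E hE).subtype) y₀) =
      (℘'[L] Ω - (W.baseChange ℂ).a₁ * (℘[L] Ω - (W.baseChange ℂ).b₂ / 12) - (W.baseChange ℂ).a₃) / 2)
    (hx₁ : algClosureEmb ι (((algebraMap (rayClassField K 𝔪r) (AlgebraicClosure K)).comp (readingRing E hE).subtype) x₁) =
      ℘[L] (ι (π₀ : K) * Ω) - (W.baseChange ℂ).b₂ / 12)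
    (hy₁ : algClosureEmb ι (((algebraMap (rayClassField K 𝔪r) (AlgebraicClosure K)).comp (readingRing E hE).subtype) y₁) =
      (℘'[L] (ι (π₀ : K) * Ω) - (W.baseChange ℂ).a₁ * (℘[L] (ι (π₀ : K) * Ω) - (W.baseChange ℂ).b₂ / 12) -
        (W.baseChange ℂ).a₃) / 2)
    (hαj : algClosureEmb ι (((algebraMap (rayClassField K 𝔪r) (AlgebraicClosure K)).comp (readingRing E hE).subtype) αR) = ι (π₀ : K)) :
    ∃ (T : PowerSeries (readingRing E hE)) (Pr Qr : Polynomial (readingRing E hE)),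
      -- hT0
      PowerSeries.constantCoeff T = 0 ∧
      -- hTP
      T.map (readingHom E hE) = (P.map ((LTCoeff.of (v.adicCompletion K)).toRingHom.comp
          ((integerEquivAdicCompletionIntegers v).trans (padicIntEquivOfDegreeOne K 2 v he hf)).symm.toRingHom)).map
        (algebraMap (LTCoeff (v.adicCompletion K)) (unitBall E)) ∧
      -- hTg : every complex/algebraic reading of `T` is `exp_W(g(π₀)·log_W)`
      (∀ (A : Type) [CommRing A] [Algebra ℚ A] (g : rayClassField K 𝔪r →+* A),
        PowerSeries.map (g.comp (readingRing E hE).subtype) T =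
          PowerSeries.subst (C (g (algebraMap K (rayClassField K 𝔪r) (π₀ : K))) * (⟨1, -1, 0, -2, -1⟩ : WeierstrassCurve A).formalLog)
            (⟨1, -1, 0, -2, -1⟩ : WeierstrassCurve A).formalExp) ∧
      -- hT (the transformation pair on the model lattice)
      (∀ z : ℂ, z ∉ L.lattice → ι (π₀ : K) * z ∉ L.lattice →
        (Polynomial.C (-16 - 16 * ι (π₀ : K)) * Polynomial.X ^ 2 + Polynomial.C (-24 - 8 * ι (π₀ : K)) * Polynomial.X +
            Polynomial.C (-49 + 35 * ι (π₀ : K)) : Polynomial ℂ).eval (℘[L] z) =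
          ℘[L] (ι (π₀ : K) * z) * (Polynomial.C 64 * Polynomial.X + Polynomial.C (64 - 16 * ι (π₀ : K)) : Polynomial ℂ).eval (℘[L] z)) ∧
      -- hQC
      (∀ z : ℂ, z ∉ L.lattice → ι (π₀ : K) * z ∉ L.lattice →
        (Polynomial.C 64 * Polynomial.X + Polynomial.C (64 - 16 * ι (π₀ : K)) : Polynomial ℂ).eval (℘[L] z) ≠ 0) ∧
      -- hs
      (1 / 16 : ℂ) ≠ 0 ∧
      -- hQr
      Qr.map ((algClosureEmb ι).comp (((algebraMap (rayClassField K 𝔪r) (AlgebraicClosure K)).comp (readingRing E hE).subtype))) =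
        Polynomial.C (1 / 16 : ℂ) * (Polynomial.C 64 * Polynomial.X + Polynomial.C (64 - 16 * ι (π₀ : K)) : Polynomial ℂ).comp
          (Polynomial.X + Polynomial.C ((W.baseChange ℂ).b₂ / 12)) ∧
      -- hPr
      Pr.map ((algClosureEmb ι).comp (((algebraMap (rayClassField K 𝔪r) (AlgebraicClosure K)).comp (readingRing E hE).subtype))) =
        Polynomial.C (1 / 16 : ℂ) *
          ((Polynomial.C (-16 - 16 * ι (π₀ : K)) * Polynomial.X ^ 2 + Polynomial.C (-24 - 8 * ι (π₀ : K)) * Polynomial.X +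
              Polynomial.C (-49 + 35 * ι (π₀ : K)) : Polynomial ℂ).comp (Polynomial.X + Polynomial.C ((W.baseChange ℂ).b₂ / 12)) -
            Polynomial.C ((W.baseChange ℂ).b₂ / 12) *
              (Polynomial.C 64 * Polynomial.X + Polynomial.C (64 - 16 * ι (π₀ : K)) : Polynomial ℂ).comp
                (Polynomial.X + Polynomial.C ((W.baseChange ℂ).b₂ / 12))) ∧
      -- hidX
      ((((W.map (Int.castRingHom (readingRing E hE))).translateX x₁ y₁).subst T + C (0 : readingRing E hE)) *
          Polynomial.aeval ((W.map (Int.castRingHom (readingRing E hE))).translateX x₀ y₀ + C (0 : readingRing E hE)) Qr =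
        Polynomial.aeval ((W.map (Int.castRingHom (readingRing E hE))).translateX x₀ y₀ + C (0 : readingRing E hE)) Pr) ∧
      -- hidY
      (C αR * (2 * PowerSeries.subst T ((W.map (Int.castRingHom (readingRing E hE))).translateY x₁ y₁) +
              C (W.map (Int.castRingHom (readingRing E hE))).a₁ *
                PowerSeries.subst T ((W.map (Int.castRingHom (readingRing E hE))).translateX x₁ y₁) +
              C (W.map (Int.castRingHom (readingRing E hE))).a₃) *
            Polynomial.aeval ((W.map (Int.castRingHom (readingRing E hE))).translateX x₀ y₀ + C (0 : readingRing E hE)) Qr +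
          (PowerSeries.subst T ((W.map (Int.castRingHom (readingRing E hE))).translateX x₁ y₁) + C (0 : readingRing E hE)) *
            Polynomial.aeval ((W.map (Int.castRingHom (readingRing E hE))).translateX x₀ y₀ + C (0 : readingRing E hE))
              (Polynomial.derivative Qr) *
            (2 * (W.map (Int.castRingHom (readingRing E hE))).translateY x₀ y₀ +
              C (W.map (Int.castRingHom (readingRing E hE))).a₁ * (W.map (Int.castRingHom (readingRing E hE))).translateX x₀ y₀ +
              C (W.map (Int.castRingHom (readingRing E hE))).a₃) =
        Polynomial.aeval ((W.map (Int.castRingHom (readingRing E hE))).translateX x₀ y₀ + C (0 : readingRing E hE))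
            (Polynomial.derivative Pr) *
          (2 * (W.map (Int.castRingHom (readingRing E hE))).translateY x₀ y₀ +
            C (W.map (Int.castRingHom (readingRing E hE))).a₁ * (W.map (Int.castRingHom (readingRing E hE))).translateX x₀ y₀ +
            C (W.map (Int.castRingHom (readingRing E hE))).a₃)) := by
  classical
  subst hW
  -- ### the model `[1,−1,0,−2,−1]` over `ℂ`
  have hbc : ((⟨1, -1, 0, -2, -1⟩ : WeierstrassCurve ℤ).baseChange ℂ) = (⟨1, -1, 0, -2, -1⟩ : WeierstrassCurve ℂ) :=
    cm7Model_map _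
  have hb12 : (⟨1, -1, 0, -2, -1⟩ : WeierstrassCurve ℂ).b₂ / 12 = -1 / 4 := cm7Model_b₂_div_twelve
  have hg₂ : L.g₂ = 35 / 4 := by rw [h₂, hbc, cm7Model_c₄_div_twelve]
  have hg₃ : L.g₃ = 49 / 8 := by rw [h₃, hbc, cm7Model_c₆_div]
  have h₂' : L.g₂ = (⟨1, -1, 0, -2, -1⟩ : WeierstrassCurve ℂ).c₄ / 12 := by rw [h₂, hbc]
  have h₃' : L.g₃ = (⟨1, -1, 0, -2, -1⟩ : WeierstrassCurve ℂ).c₆ / 216 := by rw [h₃, hbc]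
  have hx₀c := hx₀; have hy₀c := hy₀; have hx₁c := hx₁; have hy₁c := hy₁
  rw [hbc] at hx₀c hy₀c hx₁c hy₁c
  have hΩ' : ℘'[L] Ω ≠ 0 := L.derivWeierstrassP_ne_zero hΩL h2Ω
  have hαΩ' : ℘'[L] (ι (π₀ : K) * Ω) ≠ 0 := L.derivWeierstrassP_ne_zero hπΩL h2Ω₁
  -- ### the reading `φ = ι̂ ∘ j` is injective; `φ αR = ι π₀`
  have hφ : Function.Injective
      ((algClosureEmb ι).comp ((algebraMap (rayClassField K 𝔪r) (AlgebraicClosure K)).comp (readingRing E hE).subtype)) :=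
    (algClosureEmb ι).injective.comp ((algebraMap (rayClassField K 𝔪r) (AlgebraicClosure K)).injective.comp Subtype.val_injective)
  have hα : ((algClosureEmb ι).comp ((algebraMap (rayClassField K 𝔪r) (AlgebraicClosure K)).comp (readingRing E hE).subtype)) αR =
      ι (π₀ : K) := hαj
  -- ### the formal CM action `T = [π₀]_Ê` over `R` (B8a; `Exists.choose` instead of `obtain`: the goal is large)
  have hTex := exists_readingSeries_cm7FormalMulBy he hf E hE hPexp (π₀ : K) hc
  have hT0 := hTex.choose_spec.1
  have hTP := hTex.choose_spec.2.2.1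
  have hTg := hTex.choose_spec.2.2.2
  have hgπ : ((algClosureEmb ι).comp (algebraMap (rayClassField K 𝔪r) (AlgebraicClosure K)))
      (algebraMap K (rayClassField K 𝔪r) (π₀ : K)) = ι (π₀ : K) := by
    rw [RingHom.comp_apply, ← IsScalarTower.algebraMap_apply, algClosureEmb_algebraMap]
  have hTφ : PowerSeries.map
      ((algClosureEmb ι).comp ((algebraMap (rayClassField K 𝔪r) (AlgebraicClosure K)).comp (readingRing E hE).subtype)) hTex.choose =
      PowerSeries.subst (C (((algClosureEmb ι).comp ((algebraMap (rayClassField K 𝔪r) (AlgebraicClosure K)).comp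
          (readingRing E hE).subtype)) αR) *
        (⟨1, -1, 0, -2, -1⟩ : WeierstrassCurve ℂ).formalLog) (⟨1, -1, 0, -2, -1⟩ : WeierstrassCurve ℂ).formalExp := by
    have h := hTg ℂ ((algClosureEmb ι).comp (algebraMap (rayClassField K 𝔪r) (AlgebraicClosure K)))
    rw [hgπ, RingHom.comp_assoc] at h
    rw [hα]
    exact h
  -- ### the transformation pair on the model lattice and its re-centred lifts (PQ7)
  have hTpair := transformation_seven_model hw L hg₂ hg₃
  have hQC : ∀ z : ℂ, z ∉ L.lattice → ι (π₀ : K) * z ∉ L.lattice →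
      (Polynomial.C 64 * Polynomial.X + Polynomial.C (64 - 16 * ι (π₀ : K)) : Polynomial ℂ).eval (℘[L] z) ≠ 0 := by
    intro z hz hz' h0
    rw [eval_seven_QΛ_eq] at h0
    exact eval_seven_Qhat_ne_zero hw L hg₂ hg₃ hz hz' ((mul_eq_zero.mp h0).resolve_left (by norm_num))
  have hQr : (Polynomial.C 4 * Polynomial.X + Polynomial.C (3 - αR) : Polynomial (readingRing E hE)).map
      ((algClosureEmb ι).comp ((algebraMap (rayClassField K 𝔪r) (AlgebraicClosure K)).comp (readingRing E hE).subtype)) =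
      Polynomial.C (1 / 16 : ℂ) * (Polynomial.C 64 * Polynomial.X + Polynomial.C (64 - 16 * ι (π₀ : K)) : Polynomial ℂ).comp
        (Polynomial.X + Polynomial.C ((⟨1, -1, 0, -2, -1⟩ : WeierstrassCurve ℂ).b₂ / 12)) := by
    rw [map_seven_Qr _ _ hα, hb12, recenter_seven_Q]
  have hPr : (Polynomial.C (-1 - αR) * Polynomial.X ^ 2 + Polynomial.C (2 * αR - 2) : Polynomial (readingRing E hE)).map
      ((algClosureEmb ι).comp ((algebraMap (rayClassField K 𝔪r) (AlgebraicClosure K)).comp (readingRing E hE).subtype)) =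
      Polynomial.C (1 / 16 : ℂ) *
        ((Polynomial.C (-16 - 16 * ι (π₀ : K)) * Polynomial.X ^ 2 + Polynomial.C (-24 - 8 * ι (π₀ : K)) * Polynomial.X +
            Polynomial.C (-49 + 35 * ι (π₀ : K)) : Polynomial ℂ).comp
            (Polynomial.X + Polynomial.C ((⟨1, -1, 0, -2, -1⟩ : WeierstrassCurve ℂ).b₂ / 12)) -
          Polynomial.C ((⟨1, -1, 0, -2, -1⟩ : WeierstrassCurve ℂ).b₂ / 12) *
            (Polynomial.C 64 * Polynomial.X + Polynomial.C (64 - 16 * ι (π₀ : K)) : Polynomial ℂ).comp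
              (Polynomial.X + Polynomial.C ((⟨1, -1, 0, -2, -1⟩ : WeierstrassCurve ℂ).b₂ / 12))) := by
    rw [map_seven_Pr _ _ hα, hb12, recenter_seven_P]
  -- ### the series identities over `R` (B8b), with `φ αR` in place of `ι π₀`
  have hTpair' : ∀ z : ℂ, z ∉ L.lattice →
      ((algClosureEmb ι).comp ((algebraMap (rayClassField K 𝔪r) (AlgebraicClosure K)).comp (readingRing E hE).subtype)) αR * z ∉
        L.lattice →
      (Polynomial.C (-16 - 16 * ι (π₀ : K)) * Polynomial.X ^ 2 + Polynomial.C (-24 - 8 * ι (π₀ : K)) * Polynomial.X +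
          Polynomial.C (-49 + 35 * ι (π₀ : K)) : Polynomial ℂ).eval (℘[L] z) =
        ℘[L] (((algClosureEmb ι).comp ((algebraMap (rayClassField K 𝔪r) (AlgebraicClosure K)).comp (readingRing E hE).subtype)) αR * z) *
          (Polynomial.C 64 * Polynomial.X + Polynomial.C (64 - 16 * ι (π₀ : K)) : Polynomial ℂ).eval (℘[L] z) := by
    rw [hα]; exact hTpair
  have hx₁' : ((algClosureEmb ι).comp ((algebraMap (rayClassField K 𝔪r) (AlgebraicClosure K)).comp (readingRing E hE).subtype)) x₁ =
      ℘[L] (((algClosureEmb ι).comp ((algebraMap (rayClassField K 𝔪r) (AlgebraicClosure K)).comp (readingRing E hE).subtype)) αR * Ω) -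
        (⟨1, -1, 0, -2, -1⟩ : WeierstrassCurve ℂ).b₂ / 12 := by
    rw [hα]; exact hx₁c
  have hy₁' : ((algClosureEmb ι).comp ((algebraMap (rayClassField K 𝔪r) (AlgebraicClosure K)).comp (readingRing E hE).subtype)) y₁ =
      (℘'[L] (((algClosureEmb ι).comp ((algebraMap (rayClassField K 𝔪r) (AlgebraicClosure K)).comp (readingRing E hE).subtype)) αR * Ω) -
        (⟨1, -1, 0, -2, -1⟩ : WeierstrassCurve ℂ).a₁ * (℘[L] (((algClosureEmb ι).comp ((algebraMap (rayClassField K 𝔪r)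
          (AlgebraicClosure K)).comp (readingRing E hE).subtype)) αR * Ω) - (⟨1, -1, 0, -2, -1⟩ : WeierstrassCurve ℂ).b₂ / 12) -
        (⟨1, -1, 0, -2, -1⟩ : WeierstrassCurve ℂ).a₃) / 2 := by
    rw [hα]; exact hy₁c
  have hαΩL : ((algClosureEmb ι).comp ((algebraMap (rayClassField K 𝔪r) (AlgebraicClosure K)).comp (readingRing E hE).subtype)) αR * Ω ∉
      L.lattice := by
    rw [hα]; exact hπΩL
  have hαΩ'' : ℘'[L] (((algClosureEmb ι).comp ((algebraMap (rayClassField K 𝔪r) (AlgebraicClosure K)).comp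
      (readingRing E hE).subtype)) αR * Ω) ≠ 0 := by
    rw [hα]; exact hαΩ'
  have hidX := cmX_identity_of_reading
    ((algClosureEmb ι).comp ((algebraMap (rayClassField K 𝔪r) (AlgebraicClosure K)).comp (readingRing E hE).subtype))
    hφ L (1 / 16 : ℂ) x₀ y₀ x₁ y₁ αR hTex.choose hT0 _ _ h₂' h₃' hTpair' hΩL hαΩL hx₀c hy₀c hx₁' hy₁' hTφ hQr hPr
  have hidY := cmY_identity_of_reading
    ((algClosureEmb ι).comp ((algebraMap (rayClassField K 𝔪r) (AlgebraicClosure K)).comp (readingRing E hE).subtype))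
    hφ L (1 / 16 : ℂ) x₀ y₀ x₁ y₁ αR hTex.choose hT0 _ _ h₂' h₃' hTpair' hΩL hαΩL hΩ' hαΩ'' hx₀c hy₀c hx₁' hy₁' hTφ hQr hPr
  -- ### assembly (the polynomials `Pr`, `Qr` are left as holes, assigned by unification from `hPr`/`hQr`)
  refine ⟨hTex.choose, ?_, ?_, hT0, hTP, hTg, hTpair, hQC, by norm_num, ?_, ?_, ?_, ?_⟩
  rotate_left 2
  · rw [hbc]
    exact hQr
  · rw [hbc]
    exact hPr
  · exact (cm7Model_eq_map_intCast (A := readingRing E hE)) ▸ hidX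
  · exact (cm7Model_eq_map_intCast (A := readingRing E hE)) ▸ hidY

end Summit.BirchSwinnertonDyer.BirchSwinnertonDyer.Theorems.PrintCf2.KatzMeasureJZeroSeam

end
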